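import Literature.AnabelianGeometry.EtaleTheta.Discharge.Sec5Thm510iiiKummerOutRepresentative
import Literature.AnabelianGeometry.EtaleTheta.Discharge.Sec5Lem59ivOfThetaSetting
import Literature.AnabelianGeometry.EtaleTheta.RigidOfSetting

/-!
# [EtTh] §5, Theorem 5.10 (iii) AT THE GENUINE DATA: the residual {`hsemi`, `hΔ`} — `hΔ` DISCHARGED from Cor. 2.18 (i) BY NAME at the setting's
# own rigidity data, `hsemi` NOT an input of the conclusion (pp. 333–335 / PDF pp. 107–109)

Mochizuki, *The étale theta function and its Frobenioid-theoretic manifestations*, Publ. RIMS **45** (2009)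
[cite: MochizukiEtTh2009, Thm 5.10 (iii) p.334 (PDF p.108)]; Cor. 2.18 (i) p.286 (PDF p.60).  abc-iut cell, layer L2, seat abc-iut-L2-t11
(gen 6); abc-iut-L2-lead (gen 4) row **R366** «THM 5.10 (iii) RESIDUAL {hsemi (K), hΔ} AT THE GENUINE DATA» (to this lineage; basename
`Discharge/Sec5Thm510iiiResidualOfGenuine`).  PROOF-ONLY (0 definitions, 0 new `Prop` facts; nothing landed is edited), additive sequel of this
seat's `Sec5Thm510iiiKummerOutRepresentative.lean` (gen 4, p442548/p442608: Theorem 5.10 (ii) ∧ (iii) at the honest `K^×`-part `DK := kummerOut`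
from the transports + ONE dictionary binder `hD` + the clause `hΔY` for the representative `ψY`) and `Sec5Lem59ivOfThetaSetting.lean` (gen 4,
p441744: the same at abc-iut-L2-t4's junction `ofThetaSettingData`, clause `hΔ` explicit), with abc-iut-L6-t23's `aug_iff_of_cor218_i`
(`Sec5Thm510iiiKummerPart.lean`) and abc-iut-L2-t8's rigidity data of the setting `Cu.rigidData μ hC hS h15 L` (`RigidOfSetting.lean`, whose
`toThetaEnvData` IS the model `Cu.thetaEnvData μ hC hS`, `rigidData_toThetaEnvData` = `rfl`) consumed BY NAME.

THE TWO RESIDUAL BINDERS OF RECORD (NODES `EtTh:Thm5.10(iii)`, 11:44Z: «{hD, hconst, H : Facts, Thm 5.10 (ii) as typed + ψY with hΔY,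
(hopenX discharged from temperedness)}»; R366 names {`hsemi`, `hΔ`}):
* **`hΔ`** ("every topological automorphism `ψ` of `Π^tp_X̲̲` [here: the representative `ψY` of the `Π^tp_X`-conjugacy class induced by `Ψ^bs`,
  Thm. 5.10 (iii)] satisfies `aug(ψ y) = 1 ↔ aug(y) = 1` on `Π^tp_Y̲̲`", i.e. preserves `Π^tp_Y̲̲ ∩ Ker(Π^tp_X̲̲ ↠ G_K)`) is a CLAUSE of [EtTh]
  Cor. 2.18 (i) ("`(Π^tp_X ⊇) G_K` … may be reconstructed group-theoretically", typed by abc-iut-L2-t2 as `RigidData.Cor218_i`, FACT row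
  **F-0620**, «consumed BY NAME at named instances»).  HERE IT IS DISCHARGED at the genuine `Π^tp_X̲̲ = Cu.Huu` of every theta setting from
  F-0620 AT THE SETTING'S OWN RIGIDITY DATA `Cu.rigidData μ hC hS h15 L` — the same instance at which abc-iut-w4-d008's `hP24_thetaEnvTower_of_cor218_i`
  and abc-iut-w5-d123's `h44` producers take F-0620 (R474) — for EVERY `ψ`, hence for the representative: `hΔ_ofSetting_of_cor218_i`,
  `hΔ_ofThetaSettingData_of_cor218_i`.
* **`hsemi`** (`Ψ^birat_Aut(e·x) = Ψ^Aut(e)·Ψ^birat_Aut(x)`, the functoriality law relating the Ψ-transport `ΨbiratAut` on `O^×(B_N^birat)` with the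
  natural action — census cell B7 = K: "a LAW OF THE Ψ-TRANSPORT DATUM `ΨbiratAut`", i.e. of the parameter `(ΨbiratAut, hsq, hconst)` of abc-iut-L2-t4's
  `PsiAutPreserves` / `Facts.psiAutPreserves_of_transports`) is an input of this seat's INTRINSIC route (A) ONLY (`Facts.thm510_ii_iii_kummerOut`,
  p435038).  The dictionary route (B) reaches THE SAME conclusion — Theorem 5.10 (ii) ∧ (iii) at `DK := kummerOut` — with NO `hsemi`
  (`ConstantsDictionary.thm510_ii_iii_kummerOut_rep`, p442608); so at the genuine data `hsemi` is NOT a residual of Theorem 5.10 (iii): the theorems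
  below do not take it.  (It stays what it is: the third law of the Ψ^birat datum, to be proved by whoever CONSTRUCTS `Ψ^birat_Aut` from `Ψ` — [FrdI]
  Prop. 4.4 «birationalization is category-theoretic» — and needed by nobody downstream of route (B).)

RESULTS.
(1) Against abc-iut-L2-t8's model of ANY setting (generic §5 datum `𝔉`, identification `ι`): `hΔ_ofSetting_of_cor218_i`;
    `ConstantsDictionary.monoThetaEnvCompat_kummerOut_of_cor218_i` (Theorem 5.10 (iii) at `kummerOut` from {hK, §5 inputs, H, hY, hopenX, hD,
    Thm 5.10 (ii) + ψY, F-0620}); **`ConstantsDictionary.thm510_ii_iii_kummerOut_of_cor218_i`** (Theorem 5.10 (ii) ∧ (iii) at `kummerOut` from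
    the transports (Thm. 5.7 `RootTransportWith`, Thm. 4.4 (iv) `StrvTransport`) + H + hD + F-0620 — neither `hsemi` nor `hΔY`).
(2) AT THE JUNCTION `ofThetaSettingData` (abc-iut-L2-t4's §5 data OF THE SETTING over a tempered Frobenioid `tf` on `B^temp(Π^tp_X̲̲)⁰`, `ι := id`,
    `DK :=` the honest `dkOfConnectedTemperoidData … = kummerOut`): `hΔ_ofThetaSettingData_of_cor218_i`;
    **`monoThetaEnvCompat_ofThetaSettingData_of_cor218_i`** = gen 4's (J5) `monoThetaEnvCompat_ofThetaSettingData_of_constantsDictionary` with its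
    `hΔ` binder DISCHARGED; **`thm510_ii_iii_ofThetaSettingData_of_cor218_i`** — [EtTh] Theorem 5.10 (ii) ∧ (iii) for the §5 data OF THE SETTING,
    RESIDUAL EXACTLY: the junction data (`tf`, `R`, `K'`, `constEmb`, `hinvc`, `hinvp`), `hconst` (Def. 3.6 (iii)), `H : Facts` (⟸ `hconst` + `hD`,
    p440765), the ONE dictionary binder `hD`, a cyclotome reading `m`, Theorem 5.7 / Theorem 4.4 (iv) AS TYPED (`RootTransportWith`, `StrvTransport`,
    with the 1-compatible `Ψ^bs` and the Ψ^birat datum `(ΨbiratAut, hsq, hΨconst)`), the representative `ψY` (`hbase`, `hψY`, `hψYdd`), and F-0620 at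
    `Cu.rigidData μ hC hS h15 L` (with its inputs `h15 : Prop15iii`, `L : CuspLabels`).  `hopenX` ⟸ temperedness and `hY`/`hK` ⟸ rfl/`hD` as in p440765.
HONEST FRAMING: kernel-checked compositions over the typed junction; `tf` is an abstract parameter (the tempered Frobenioid of an actual curve is
not inhabited in the tree); F-0620 is a named (unproved, instance-form) fact; nothing of [EtTh] is asserted unconditionally; typed ≠ proved; no
side is taken on anything downstream ([IUTchIII] Cor. 3.12).
-/

noncomputable section

namespace Literature.AnabelianGeometry.EtaleTheta

open CategoryTheory Opposite Literature.AlgebraicGeometry.Frobenioids Literature.AnabelianGeometry.SemiGraphs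
  Literature.AnabelianGeometry.SemiGraphs.GaloisObjects Literature.AlgebraicGeometry.Frobenioids.QuasiTemperoid.BTempConnected
open scoped Pointwise

universe w u u' v' v₀

namespace ThetaFrobenioid

/-! ### (1) Against the model of ANY setting: `hΔ` from F-0620 at the setting's own rigidity data -/

section Setting

variable {C₀ : Type u} [Category.{0} C₀] {D₀ : Type u'} [Category.{v'} D₀] (𝔉 : ThetaFrobenioid.{w} C₀ D₀)
  {p : ℕ} [Fact p.Prime] {D : ThetaSetting p} {E : D.EtaleThetaData} {l : ℕ} (Cu : E.DoubleUnderline l)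
  (μ : D.CyclotomeMod l 𝔉.N) (hC : D.Compat) (hS : D.Sec2Hyps) (h15 : ThetaSetting.Prop15iii E hC) (L : Cu.CuspLabels)
  (ι : 𝔉.PiX ≃ₜ* (Cu.thetaEnvData μ hC hS).PiX)

/-- **The clause `hΔ` at the genuine `Π^tp_X̲̲` of a theta setting, from [EtTh] Cor. 2.18 (i) BY NAME (F-0620) AT THE SETTING'S OWN RIGIDITY DATA**
(abc-iut-L2-t8's `Cu.rigidData μ hC hS h15 L`, whose underlying `ThetaEnvData` is the model `Cu.thetaEnvData μ hC hS` by `rfl`): for EVERY topological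
automorphism `ψ` of `Π^tp_X̲` (identified with `Π^tp_X̲̲` along `ι`) and every `y ∈ Π^tp_Y̲`, `aug(ι(ψ y)) = 1 ↔ aug(ι y) = 1` — "`(Π^tp_X ⊇) G_K` … may be
reconstructed group-theoretically" (abc-iut-L6-t23's `aug_iff_of_cor218_i`).  [cite: MochizukiEtTh2009, Cor 2.18 (i) p.286 (PDF p.60)] -/
theorem hΔ_ofSetting_of_cor218_i (h218 : (Cu.rigidData μ hC hS h15 L).Cor218_i) (ψ : 𝔉.PiX ≃ₜ* 𝔉.PiX) :
    ∀ y ∈ 𝔉.PiY, (Cu.thetaEnvData μ hC hS).aug (ι (ψ y)) = 1 ↔ (Cu.thetaEnvData μ hC hS).aug (ι y) = 1 :=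
  𝔉.aug_iff_of_cor218_i (Cu.rigidData μ hC hS h15 L) ι h218 ψ

end Setting

namespace BiratAutAction

namespace ConstantsDictionary

variable {C₀ : Type u} [Category.{0} C₀] {D₀ : Type u'} [Category.{v'} D₀] {𝔉 : ThetaFrobenioid.{w} C₀ D₀}
  {α : 𝔉.BiratAutAction} {p : ℕ} [Fact p.Prime] {D : ThetaSetting p} {E : D.EtaleThetaData} {l : ℕ}
  {Cu : E.DoubleUnderline l} {μ : D.CyclotomeMod l 𝔉.N} {hC : D.Compat} {hS : D.Sec2Hyps}
  {ι : 𝔉.PiX ≃ₜ* (Cu.thetaEnvData μ hC hS).PiX} {m : 𝔉.muTorsion 𝔉.BN 𝔉.N ≃* (Cu.thetaEnvData μ hC hS).mu}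
  {Cst : Subgroup (𝔉.biratUnits 𝔉.BN)} {ν' : Cst →* (PadicAlgCl p)ˣ}
  (hD : ConstantsDictionary α Cu μ hC hS ι m Cst ν') (h15 : ThetaSetting.Prop15iii E hC) (L : Cu.CuspLabels)
include hD

/-- **[EtTh] Theorem 5.10 (iii) at `DK := kummerOut` against the model of the setting from the ONE binder, with the clause `hΔY` DISCHARGED from
Cor. 2.18 (i) BY NAME (F-0620) at the setting's rigidity data** (gen 4's `monoThetaEnvCompat_kummerOut_rep` ∘ `hΔ_ofSetting_of_cor218_i`).  Residual:
`hK`, the §5 inputs, `H`, `hY`, `hopenX`, `hD`, Theorem 5.10 (ii) as typed + the representative `ψY`, F-0620 (+ `h15`, `L`) — NO `hsemi`, NO raw `hΔ`.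
[cite: MochizukiEtTh2009, Thm 5.10 (iii) p.334–335 (PDF pp.108–109); Cor 2.18 (i) p.286 (PDF p.60)] -/
theorem monoThetaEnvCompat_kummerOut_of_cor218_i (h218 : (Cu.rigidData μ hC hS h15 L).Cor218_i)
    (hK : 𝔉.KxRootNModCyclotome) (h1 : 𝔉.SectionsFactor) (h3 : 𝔉.OuterActionLZ)
    (hsec : 𝔉.SgpCapSection) (hcs : 𝔉.SgpCupSection) (h8 : 𝔉.ConstantsEqNormalizer) (H : 𝔉.Facts)
    (hY : 𝔉.IdentifiesPiY (Cu.thetaEnvData μ hC hS) ι.toMulEquiv)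
    (hopenX : IsOpenMap fun x : D.PiTemp => (⟨D.aug x, D.aug_mem_GK x⟩ : D.GK))
    (Ψ : C₀ ≌ C₀) (β : Ψ.functor.obj 𝔉.BN ≅ 𝔉.BN) (ΨbiratAut : 𝔉.biratUnits 𝔉.BN ≃* 𝔉.biratUnits 𝔉.BN)
    (hii : 𝔉.PsiAutPreserves Ψ β ΨbiratAut) (ψY : 𝔉.PiX ≃ₜ* 𝔉.PiX)
    (hbase : ∀ g, 𝔉.autBase 𝔉.BN (𝔉.psiAut Ψ β (𝔉.sgpCap (𝔉.ρ g))) = 𝔉.ρ (ψY g))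
    (hψY : 𝔉.PiY.map ψY.toMulEquiv.toMonoidHom = 𝔉.PiY)
    (hψYdd : 𝔉.PiYdd.map ψY.toMulEquiv.toMonoidHom = 𝔉.PiYdd) :
    𝔉.MonoThetaEnvCompat h1 h3 hsec hcs h8 (α.kummerOut hK) Ψ β ψY hbase hψY hψYdd :=
  hD.monoThetaEnvCompat_kummerOut_rep hK h1 h3 hsec hcs h8 H hY hopenX Ψ β ΨbiratAut hii ψY hbase hψY hψYdd
    (𝔉.hΔ_ofSetting_of_cor218_i Cu μ hC hS h15 L ι h218 ψY)

/-- **[EtTh] Theorem 5.10 (ii) ∧ (iii) at the honest `K^×`-part `DK := kummerOut` against the model of the setting, from Theorem 5.7 and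
Theorem 4.4 (iv) AS TYPED (the transports), the bundled §5 facts, the ONE dictionary binder and F-0620** (gen 4's `thm510_ii_iii_kummerOut_rep` ∘
`hΔ_ofSetting_of_cor218_i`): the residual {`hsemi`, `hΔ`} of R366 is GONE — `hsemi` is not an input of this (dictionary) route, `hΔ` is Cor. 2.18 (i)
BY NAME at the setting's rigidity data.  [cite: MochizukiEtTh2009, Thm 5.10 (ii)(iii) p.333–335 (PDF pp.107–109); Cor 2.18 (i) p.286 (PDF p.60)] -/
theorem thm510_ii_iii_kummerOut_of_cor218_i (h218 : (Cu.rigidData μ hC hS h15 L).Cor218_i) (H : 𝔉.Facts)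
    (hK : 𝔉.KxRootNModCyclotome) (hY : 𝔉.IdentifiesPiY (Cu.thetaEnvData μ hC hS) ι.toMulEquiv)
    (hopenX : IsOpenMap fun x : D.PiTemp => (⟨D.aug x, D.aug_mem_GK x⟩ : D.GK))
    (Ψ : C₀ ≌ C₀) (β : Ψ.functor.obj 𝔉.BN ≅ 𝔉.BN) (ΨbiratAut : 𝔉.biratUnits 𝔉.BN ≃* 𝔉.biratUnits 𝔉.BN)
    (Ψbs : D₀ ⥤ D₀) [Ψbs.Faithful] (eΨ : Ψ.functor ⋙ 𝔉.base ≅ 𝔉.base ⋙ Ψbs)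
    (hsq : ∀ u : 𝔉.units 𝔉.BN, ∀ hu : 𝔉.psiAut Ψ β u ∈ 𝔉.units 𝔉.BN,
      ΨbiratAut (𝔉.unitsToBirat 𝔉.BN u) = 𝔉.unitsToBirat 𝔉.BN ⟨_, hu⟩)
    (hconst : 𝔉.constEmb.range.map ΨbiratAut.toMonoidHom = 𝔉.constEmb.range)
    (αA : Ψ.functor.obj 𝔉.AN ≅ 𝔉.AN) (eA : 𝔉.AN ≅ 𝔉.AN) (Dc Dp : Aut 𝔉.BN)
    (hRT : 𝔉.RootTransportWith Ψ αA β eA Dc Dp)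
    (θ : Aut (𝔉.base.obj 𝔉.BN) ≃* Aut (𝔉.base.obj 𝔉.BN)) (hST : 𝔉.StrvTransport Ψ αA eA θ)
    (hθY : 𝔉.imPiY.map θ.toMonoidHom = 𝔉.imPiY) (hθYdd : 𝔉.HB.map θ.toMonoidHom = 𝔉.HB)
    (ψY : 𝔉.PiX ≃ₜ* 𝔉.PiX)
    (hbase : ∀ g, 𝔉.autBase 𝔉.BN (𝔉.psiAut Ψ β (𝔉.sgpCap (𝔉.ρ g))) = 𝔉.ρ (ψY g))
    (hψY : 𝔉.PiY.map ψY.toMulEquiv.toMonoidHom = 𝔉.PiY)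
    (hψYdd : 𝔉.PiYdd.map ψY.toMulEquiv.toMonoidHom = 𝔉.PiYdd) :
    𝔉.PsiAutPreserves Ψ β ΨbiratAut ∧
      𝔉.MonoThetaEnvCompat H.sectionsFactor 𝔉.outerActionLZ_of H.sgpCapSection H.sgpCupSection
        H.constantsEqNormalizer (α.kummerOut hK) Ψ β ψY hbase hψY hψYdd :=
  hD.thm510_ii_iii_kummerOut_rep H hK hY hopenX Ψ β ΨbiratAut Ψbs eΨ hsq hconst αA eA Dc Dp hRT θ hST hθY hθYdd ψY hbase
    hψY hψYdd (𝔉.hΔ_ofSetting_of_cor218_i Cu μ hC hS h15 L ι h218 ψY)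

end ConstantsDictionary

end BiratAutAction

/-! ### (2) AT THE JUNCTION `ofThetaSettingData` (abc-iut-L2-t4's §5 data OF THE SETTING) -/

section Junction


variable {p : ℕ} [Fact p.Prime] {D : ThetaSetting p} {E : D.EtaleThetaData} {l : ℕ} {C : E.DoubleUnderline l}
  {e : D.toTemperedCurve.GroupLevelData} {N : ℕ+} (μ : D.CyclotomeMod l N) (hC : D.Compat) (hS : D.Sec2Hyps)
  {D₀ : Type} [Category.{v₀} D₀] {V : FrdIMonoidStub.{0}} {T₀ : RealifiedDivisorMonoids (D₀ := D₀) V}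
  {VD : FrdICatStub.{1, 0, 0} (ConnectedPart (BTemp (C.temperedArithmeticGroup e).Pi))}
  {tf : TemperedFrobenioid T₀ (ConnectedPart (BTemp (C.temperedArithmeticGroup e).Pi)) VD} {hZ : tf.monoidType = MonoidType.Z}
  {hP : ∀ A : (ConnectedPart (BTemp (C.temperedArithmeticGroup e).Pi))ᵒᵖ, IsPerfect (tf.Φ.carrier A)}
  {NH : Subgroup (Field.absoluteGaloisGroup D.K) → tf.category → ℕ+ → Prop} {A₀ : tf.category}
  {hA₀ : PreFrobenioid.IsFrobeniusTrivial tf.toElem A₀} {hA₀' : SemiGraphs.IsGaloisObj A₀.base.obj}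
  {pullFrac : ∀ {A A' : (BiKummerSetting.mkOfConnectedTemperoid (C.temperedArithmeticGroup e) tf hZ hP NH A₀ hA₀ hA₀').C} (_ : A' ⟶ A),
    (BiKummerSetting.mkOfConnectedTemperoid (C.temperedArithmeticGroup e) tf hZ hP NH A₀ hA₀ hA₀').biratUnits A →
      (BiKummerSetting.mkOfConnectedTemperoid (C.temperedArithmeticGroup e) tf hZ hP NH A₀ hA₀ hA₀').biratUnits A'}
  {θ : (BiKummerSetting.mkOfConnectedTemperoid (C.temperedArithmeticGroup e) tf hZ hP NH A₀ hA₀ hA₀').biratUnits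
    (BiKummerSetting.mkOfConnectedTemperoid (C.temperedArithmeticGroup e) tf hZ hP NH A₀ hA₀ hA₀').Aodot}
  {Bl : (BiKummerSetting.mkOfConnectedTemperoid (C.temperedArithmeticGroup e) tf hZ hP NH A₀ hA₀ hA₀').C}
  {Pl : (BiKummerSetting.mkOfConnectedTemperoid (C.temperedArithmeticGroup e) tf hZ hP NH A₀ hA₀ hA₀').FractionPair θ Bl}
  {Rl : (BiKummerSetting.mkOfConnectedTemperoid (C.temperedArithmeticGroup e) tf hZ hP NH A₀ hA₀ hA₀').NthRoot θ Pl C.lPNat pullFrac}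
  (h : ModelFrobenioid.Hypotheses tf.divisorMonoid tf.ratFnFunctor)
  (Q : FrobenioidTheta.ThetaSubquotientStub.{0} (ConnectedPart (BTemp (C.temperedArithmeticGroup e).Pi)))
  (R : (BiKummerSetting.mkOfConnectedTemperoid (C.temperedArithmeticGroup e) tf hZ hP NH A₀ hA₀ hA₀').NthRoot Rl.root Rl.pair N pullFrac)
  (K' : Type) [Field K'] (constEmb : K'ˣ →* tf.biratUnitsModel R.BN) (constEmb_injective : Function.Injective constEmb)
  (hinvc : ∀ g : Aut R.AN.base,
    pull tf.divisorMonoid g.hom (ModelFrobenioid.div R.pair.num) = ModelFrobenioid.div R.pair.num)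
  (hinvp : ∀ y : (C.thetaEnvData μ hC hS).PiX, y ∈ (C.thetaEnvData μ hC hS).PiYdd →
    pull tf.divisorMonoid ((BiKummerSetting.mkOfConnectedTemperoid (C.temperedArithmeticGroup e) tf hZ hP NH A₀ hA₀ hA₀').galoisSurj
      R.AN.base R.αData.isGalois ((ContinuousMulEquiv.refl _) y)).hom (ModelFrobenioid.div R.pair.den) = ModelFrobenioid.div R.pair.den)
  (hconst : ∀ (ε : Aut R.BN) (k : K'ˣ), tf.biratAutModel R.BN ε (constEmb k) = constEmb k)
  (m : (ofThetaSettingData μ hC hS h Q R K' constEmb constEmb_injective hinvc hinvp).muTorsion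
      (ofThetaSettingData μ hC hS h Q R K' constEmb constEmb_injective hinvc hinvp).BN N ≃* (C.thetaEnvData μ hC hS).mu)
  {Cst : Subgroup ((ofThetaSettingData μ hC hS h Q R K' constEmb constEmb_injective hinvc hinvp).biratUnits
      (ofThetaSettingData μ hC hS h Q R K' constEmb constEmb_injective hinvc hinvp).BN)}
  {ν' : Cst →* (PadicAlgCl p)ˣ}
  (hD : BiratAutAction.ConstantsDictionary
    (biratAutAction_ofConnectedTemperoidData (T := C.thetaEnvData μ hC hS) h Q C.odd_lPNat R (ContinuousMulEquiv.refl _) K' constEmb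
      constEmb_injective hinvc hinvp hconst) C μ hC hS (ContinuousMulEquiv.refl _) m Cst ν')
  (h15 : ThetaSetting.Prop15iii E hC) (L : C.CuspLabels)

/-- **The clause `hΔ` of gen 4's (J5) `monoThetaEnvCompat_ofThetaSettingData_of_constantsDictionary` DISCHARGED at the junction from F-0620** (Cor. 2.18
(i) at the setting's rigidity data `C.rigidData μ hC hS h15 L`; `ι := id`): for every topological automorphism `ψ` of `Π^tp_X̲̲ = C.Huu` and every
`y ∈ Π^tp_Y̲̲`, `aug(ψ y) = 1 ↔ aug(y) = 1`.  [cite: MochizukiEtTh2009, Cor 2.18 (i) p.286 (PDF p.60)] -/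
theorem hΔ_ofThetaSettingData_of_cor218_i (h218 : (C.rigidData μ hC hS h15 L).Cor218_i)
    (ψ : (ofThetaSettingData μ hC hS h Q R K' constEmb constEmb_injective hinvc hinvp).PiX ≃ₜ*
      (ofThetaSettingData μ hC hS h Q R K' constEmb constEmb_injective hinvc hinvp).PiX) :
    ∀ y ∈ (ofThetaSettingData μ hC hS h Q R K' constEmb constEmb_injective hinvc hinvp).PiY,
      (C.thetaEnvData μ hC hS).aug ((ContinuousMulEquiv.refl _) (ψ y)) = 1 ↔
        (C.thetaEnvData μ hC hS).aug ((ContinuousMulEquiv.refl (C.thetaEnvData μ hC hS).PiX) y) = 1 :=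
  (ofThetaSettingData μ hC hS h Q R K' constEmb constEmb_injective hinvc hinvp).hΔ_ofSetting_of_cor218_i C μ hC hS h15 L
    (ContinuousMulEquiv.refl _) h218 ψ

include hD

/-- **[EtTh] Theorem 5.10 (iii) (abc-iut-L2-t4's `MonoThetaEnvCompat`) for the §5 data OF THE SETTING at the honest `DK`, from the ONE dictionary binder,
with the clause `hΔ` DISCHARGED from F-0620** (gen 4's (J5) `monoThetaEnvCompat_ofThetaSettingData_of_constantsDictionary` ∘ `hΔ_ofThetaSettingData_of_cor218_i`).
Residual: `H : Facts` (⟸ `hconst` + `hD`), Theorem 5.10 (ii) as typed with the representative `ψY`, F-0620 at `C.rigidData μ hC hS h15 L`.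
[cite: MochizukiEtTh2009, Thm 5.10 (iii) p.334–335 (PDF pp.108–109); Cor 2.18 (i) p.286 (PDF p.60)] -/
theorem monoThetaEnvCompat_ofThetaSettingData_of_cor218_i (h218 : (C.rigidData μ hC hS h15 L).Cor218_i)
    (h1 : (ofThetaSettingData μ hC hS h Q R K' constEmb constEmb_injective hinvc hinvp).SectionsFactor)
    (h3 : (ofThetaSettingData μ hC hS h Q R K' constEmb constEmb_injective hinvc hinvp).OuterActionLZ)
    (hsec : (ofThetaSettingData μ hC hS h Q R K' constEmb constEmb_injective hinvc hinvp).SgpCapSection)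
    (hcs : (ofThetaSettingData μ hC hS h Q R K' constEmb constEmb_injective hinvc hinvp).SgpCupSection)
    (h8 : (ofThetaSettingData μ hC hS h Q R K' constEmb constEmb_injective hinvc hinvp).ConstantsEqNormalizer)
    (H : (ofThetaSettingData μ hC hS h Q R K' constEmb constEmb_injective hinvc hinvp).Facts)
    (Ψ : (BiKummerSetting.mkOfConnectedTemperoid (C.temperedArithmeticGroup e) tf hZ hP NH A₀ hA₀ hA₀').C ≌
      (BiKummerSetting.mkOfConnectedTemperoid (C.temperedArithmeticGroup e) tf hZ hP NH A₀ hA₀ hA₀').C)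
    (β : Ψ.functor.obj (ofThetaSettingData μ hC hS h Q R K' constEmb constEmb_injective hinvc hinvp).BN ≅
      (ofThetaSettingData μ hC hS h Q R K' constEmb constEmb_injective hinvc hinvp).BN)
    (ΨbiratAut : (ofThetaSettingData μ hC hS h Q R K' constEmb constEmb_injective hinvc hinvp).biratUnits
        (ofThetaSettingData μ hC hS h Q R K' constEmb constEmb_injective hinvc hinvp).BN ≃*
      (ofThetaSettingData μ hC hS h Q R K' constEmb constEmb_injective hinvc hinvp).biratUnits
        (ofThetaSettingData μ hC hS h Q R K' constEmb constEmb_injective hinvc hinvp).BN)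
    (hii : (ofThetaSettingData μ hC hS h Q R K' constEmb constEmb_injective hinvc hinvp).PsiAutPreserves Ψ β ΨbiratAut)
    (ψY : (ofThetaSettingData μ hC hS h Q R K' constEmb constEmb_injective hinvc hinvp).PiX ≃ₜ*
      (ofThetaSettingData μ hC hS h Q R K' constEmb constEmb_injective hinvc hinvp).PiX)
    (hbase : ∀ g, (ofThetaSettingData μ hC hS h Q R K' constEmb constEmb_injective hinvc hinvp).autBase
        (ofThetaSettingData μ hC hS h Q R K' constEmb constEmb_injective hinvc hinvp).BN
        ((ofThetaSettingData μ hC hS h Q R K' constEmb constEmb_injective hinvc hinvp).psiAut Ψ β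
          ((ofThetaSettingData μ hC hS h Q R K' constEmb constEmb_injective hinvc hinvp).sgpCap
            ((ofThetaSettingData μ hC hS h Q R K' constEmb constEmb_injective hinvc hinvp).ρ g))) =
      (ofThetaSettingData μ hC hS h Q R K' constEmb constEmb_injective hinvc hinvp).ρ (ψY g))
    (hψY : (ofThetaSettingData μ hC hS h Q R K' constEmb constEmb_injective hinvc hinvp).PiY.map ψY.toMulEquiv.toMonoidHom =
      (ofThetaSettingData μ hC hS h Q R K' constEmb constEmb_injective hinvc hinvp).PiY)
    (hψYdd : (ofThetaSettingData μ hC hS h Q R K' constEmb constEmb_injective hinvc hinvp).PiYdd.map ψY.toMulEquiv.toMonoidHom =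
      (ofThetaSettingData μ hC hS h Q R K' constEmb constEmb_injective hinvc hinvp).PiYdd) :
    (ofThetaSettingData μ hC hS h Q R K' constEmb constEmb_injective hinvc hinvp).MonoThetaEnvCompat h1 h3 hsec hcs h8
      (dkOfConnectedTemperoidData (T := C.thetaEnvData μ hC hS) h Q C.odd_lPNat R (ContinuousMulEquiv.refl _) K' constEmb
        constEmb_injective hinvc hinvp hconst
        (kxRootNModCyclotome_ofThetaSettingData_of_constantsDictionary μ hC hS h Q R K' constEmb constEmb_injective hinvc hinvp hconst m hD))
      Ψ β ψY hbase hψY hψYdd :=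
  monoThetaEnvCompat_ofThetaSettingData_of_constantsDictionary μ hC hS h Q R K' constEmb constEmb_injective hinvc hinvp hconst m hD h1 h3 hsec
    hcs h8 H (hΔ_ofThetaSettingData_of_cor218_i μ hC hS h Q R K' constEmb constEmb_injective hinvc hinvp h15 L h218) Ψ β ΨbiratAut hii ψY hbase
    hψY hψYdd

/-- **[EtTh] Theorem 5.10 (ii) ∧ (iii) FOR THE §5 DATA OF THE SETTING at the honest `DK`** — from Theorem 5.7 and Theorem 4.4 (iv) AS TYPED (the
transports `RootTransportWith`, `StrvTransport` with the 1-compatible `Ψ^bs` and the Ψ^birat datum `(ΨbiratAut, hsq, hΨconst)`), the bundled §5 facts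
`H`, the ONE dictionary binder `hD`, the representative `ψY`, and F-0620 at the setting's rigidity data; `hY` is `rfl`, `hK` ⟸ `hD`, `hopenX` ⟸
temperedness (abc-iut-L3's `isOpenMap_augGK_of_isTempered`), `hΔ` ⟸ F-0620 — the R366 residual {`hsemi`, `hΔ`} is GONE at the genuine data.
[cite: MochizukiEtTh2009, Thm 5.10 (ii)(iii) p.333–335 (PDF pp.107–109); Thm 5.7 p.329 (PDF p.103); Thm 4.4 (iv) p.320 (PDF p.94); Cor 2.18 (i) p.286 (PDF p.60)] -/
theorem thm510_ii_iii_ofThetaSettingData_of_cor218_i (h218 : (C.rigidData μ hC hS h15 L).Cor218_i)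
    (H : (ofThetaSettingData μ hC hS h Q R K' constEmb constEmb_injective hinvc hinvp).Facts)
    (Ψ : (BiKummerSetting.mkOfConnectedTemperoid (C.temperedArithmeticGroup e) tf hZ hP NH A₀ hA₀ hA₀').C ≌
      (BiKummerSetting.mkOfConnectedTemperoid (C.temperedArithmeticGroup e) tf hZ hP NH A₀ hA₀ hA₀').C)
    (β : Ψ.functor.obj (ofThetaSettingData μ hC hS h Q R K' constEmb constEmb_injective hinvc hinvp).BN ≅
      (ofThetaSettingData μ hC hS h Q R K' constEmb constEmb_injective hinvc hinvp).BN)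
    (ΨbiratAut : (ofThetaSettingData μ hC hS h Q R K' constEmb constEmb_injective hinvc hinvp).biratUnits
        (ofThetaSettingData μ hC hS h Q R K' constEmb constEmb_injective hinvc hinvp).BN ≃*
      (ofThetaSettingData μ hC hS h Q R K' constEmb constEmb_injective hinvc hinvp).biratUnits
        (ofThetaSettingData μ hC hS h Q R K' constEmb constEmb_injective hinvc hinvp).BN)
    (Ψbs : ConnectedPart (BTemp (C.temperedArithmeticGroup e).Pi) ⥤ ConnectedPart (BTemp (C.temperedArithmeticGroup e).Pi))
    [Ψbs.Faithful]
    (eΨ : Ψ.functor ⋙ (ofThetaSettingData μ hC hS h Q R K' constEmb constEmb_injective hinvc hinvp).base ≅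
      (ofThetaSettingData μ hC hS h Q R K' constEmb constEmb_injective hinvc hinvp).base ⋙ Ψbs)
    (hsq : ∀ u : (ofThetaSettingData μ hC hS h Q R K' constEmb constEmb_injective hinvc hinvp).units
        (ofThetaSettingData μ hC hS h Q R K' constEmb constEmb_injective hinvc hinvp).BN,
      ∀ hu : (ofThetaSettingData μ hC hS h Q R K' constEmb constEmb_injective hinvc hinvp).psiAut Ψ β u ∈
        (ofThetaSettingData μ hC hS h Q R K' constEmb constEmb_injective hinvc hinvp).units
          (ofThetaSettingData μ hC hS h Q R K' constEmb constEmb_injective hinvc hinvp).BN,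
      ΨbiratAut ((ofThetaSettingData μ hC hS h Q R K' constEmb constEmb_injective hinvc hinvp).unitsToBirat
          (ofThetaSettingData μ hC hS h Q R K' constEmb constEmb_injective hinvc hinvp).BN u) =
        (ofThetaSettingData μ hC hS h Q R K' constEmb constEmb_injective hinvc hinvp).unitsToBirat
          (ofThetaSettingData μ hC hS h Q R K' constEmb constEmb_injective hinvc hinvp).BN ⟨_, hu⟩)
    (hΨconst : (ofThetaSettingData μ hC hS h Q R K' constEmb constEmb_injective hinvc hinvp).constEmb.range.map ΨbiratAut.toMonoidHom =
      (ofThetaSettingData μ hC hS h Q R K' constEmb constEmb_injective hinvc hinvp).constEmb.range)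
    (αA : Ψ.functor.obj (ofThetaSettingData μ hC hS h Q R K' constEmb constEmb_injective hinvc hinvp).AN ≅
      (ofThetaSettingData μ hC hS h Q R K' constEmb constEmb_injective hinvc hinvp).AN)
    (eA : (ofThetaSettingData μ hC hS h Q R K' constEmb constEmb_injective hinvc hinvp).AN ≅
      (ofThetaSettingData μ hC hS h Q R K' constEmb constEmb_injective hinvc hinvp).AN)
    (Dc Dp : Aut (ofThetaSettingData μ hC hS h Q R K' constEmb constEmb_injective hinvc hinvp).BN)
    (hRT : (ofThetaSettingData μ hC hS h Q R K' constEmb constEmb_injective hinvc hinvp).RootTransportWith Ψ αA β eA Dc Dp)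
    (θ : Aut ((ofThetaSettingData μ hC hS h Q R K' constEmb constEmb_injective hinvc hinvp).base.obj
        (ofThetaSettingData μ hC hS h Q R K' constEmb constEmb_injective hinvc hinvp).BN) ≃*
      Aut ((ofThetaSettingData μ hC hS h Q R K' constEmb constEmb_injective hinvc hinvp).base.obj
        (ofThetaSettingData μ hC hS h Q R K' constEmb constEmb_injective hinvc hinvp).BN))
    (hST : (ofThetaSettingData μ hC hS h Q R K' constEmb constEmb_injective hinvc hinvp).StrvTransport Ψ αA eA θ)
    (hθY : (ofThetaSettingData μ hC hS h Q R K' constEmb constEmb_injective hinvc hinvp).imPiY.map θ.toMonoidHom =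
      (ofThetaSettingData μ hC hS h Q R K' constEmb constEmb_injective hinvc hinvp).imPiY)
    (hθYdd : (ofThetaSettingData μ hC hS h Q R K' constEmb constEmb_injective hinvc hinvp).HB.map θ.toMonoidHom =
      (ofThetaSettingData μ hC hS h Q R K' constEmb constEmb_injective hinvc hinvp).HB)
    (ψY : (ofThetaSettingData μ hC hS h Q R K' constEmb constEmb_injective hinvc hinvp).PiX ≃ₜ*
      (ofThetaSettingData μ hC hS h Q R K' constEmb constEmb_injective hinvc hinvp).PiX)
    (hbase : ∀ g, (ofThetaSettingData μ hC hS h Q R K' constEmb constEmb_injective hinvc hinvp).autBase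
        (ofThetaSettingData μ hC hS h Q R K' constEmb constEmb_injective hinvc hinvp).BN
        ((ofThetaSettingData μ hC hS h Q R K' constEmb constEmb_injective hinvc hinvp).psiAut Ψ β
          ((ofThetaSettingData μ hC hS h Q R K' constEmb constEmb_injective hinvc hinvp).sgpCap
            ((ofThetaSettingData μ hC hS h Q R K' constEmb constEmb_injective hinvc hinvp).ρ g))) =
      (ofThetaSettingData μ hC hS h Q R K' constEmb constEmb_injective hinvc hinvp).ρ (ψY g))
    (hψY : (ofThetaSettingData μ hC hS h Q R K' constEmb constEmb_injective hinvc hinvp).PiY.map ψY.toMulEquiv.toMonoidHom =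
      (ofThetaSettingData μ hC hS h Q R K' constEmb constEmb_injective hinvc hinvp).PiY)
    (hψYdd : (ofThetaSettingData μ hC hS h Q R K' constEmb constEmb_injective hinvc hinvp).PiYdd.map ψY.toMulEquiv.toMonoidHom =
      (ofThetaSettingData μ hC hS h Q R K' constEmb constEmb_injective hinvc hinvp).PiYdd) :
    (ofThetaSettingData μ hC hS h Q R K' constEmb constEmb_injective hinvc hinvp).PsiAutPreserves Ψ β ΨbiratAut ∧
      (ofThetaSettingData μ hC hS h Q R K' constEmb constEmb_injective hinvc hinvp).MonoThetaEnvCompat H.sectionsFactor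
        (ofThetaSettingData μ hC hS h Q R K' constEmb constEmb_injective hinvc hinvp).outerActionLZ_of H.sgpCapSection H.sgpCupSection
        H.constantsEqNormalizer
        (dkOfConnectedTemperoidData (T := C.thetaEnvData μ hC hS) h Q C.odd_lPNat R (ContinuousMulEquiv.refl _) K' constEmb
          constEmb_injective hinvc hinvp hconst
          (kxRootNModCyclotome_ofThetaSettingData_of_constantsDictionary μ hC hS h Q R K' constEmb constEmb_injective hinvc hinvp hconst m hD))
        Ψ β ψY hbase hψY hψYdd :=
  hD.thm510_ii_iii_kummerOut_of_cor218_i h15 L h218 H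
    (kxRootNModCyclotome_ofThetaSettingData_of_constantsDictionary μ hC hS h Q R K' constEmb constEmb_injective hinvc hinvp hconst m hD)
    (identifiesPiY_ofThetaSettingData μ hC hS h Q R K' constEmb constEmb_injective hinvc hinvp)
    (by haveI := e.secondCountableTopology; exact D.toTemperedCurve.isOpenMap_augGK_of_isTempered e.isTempered)
    Ψ β ΨbiratAut Ψbs eΨ hsq hΨconst αA eA Dc Dp hRT θ hST hθY hθYdd ψY hbase hψY hψYdd

end Junction

end ThetaFrobenioid

end Literature.AnabelianGeometry.EtaleTheta

end
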